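import Summits.CriticalPhenomena.CardyFormulaZ2.Theorems.CardyComplexConeSLESixFamiliesGiveCardyDefs

/-!
# drefute gen-6 — two small side lemmas for STUB A `stub_upperFence` (crux `SLESixFamiliesGiveCardy`,
stmt-CriticalPhenomena-9654, line `collar-touch-sandwich`)

* `DrefuteG6.disjoint_of_isPreconnected_of_disjoint_frontier` — the UNIFORM SIDE step of the fence
  argument: a (pre)connected set (the ball `B(a⁺, τ)`) that misses `frontier U₁` and contains a
  point outside the open set `U₁` (the mark `a⁺ ∈ ∂D`) misses `U₁`; applied with Newman's
  `frontier U₁ = L′ ∪ boundary '' Icc s t`, it puts the first inner face of the exploration in the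
  other component `U₂`, uniformly in the configuration.
* `DrefuteG6.exists_mem_zdArcB_of_not_mem_bcBondConfig` — the DICTIONARY step: an `ω`-open edge of
  the discrete domain which is closed under the Dobrushin boundary condition has an endpoint on
  the dual-wired discrete arc `zdArcB`.
Positive helpers, NOT refutations. `lean check`: rc 0, 0 sorries, 0 warnings.
-/

noncomputable section

open Set Filter Topology Metric
open Literature.Probability Literature.Probability.RandomPlanarGeometry
  Literature.Probability.LatticeModels

namespace Summit.CriticalPhenomena.CardyFormulaZ2.Cruxes.SLESixFamiliesGiveCardy.CollarTouchSandwich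

namespace DrefuteG6

/-- A preconnected set missing the frontier of an open set `U` and containing a point outside `U`
is disjoint from `U`. [folklore] -/
theorem disjoint_of_isPreconnected_of_disjoint_frontier {X : Type*} [TopologicalSpace X]
    {B U : Set X} (hB : IsPreconnected B) (hU : IsOpen U) (hfr : Disjoint B (frontier U))
    {a : X} (haB : a ∈ B) (haU : a ∉ U) : Disjoint B U := by
  have hcover : B ⊆ U ∪ (closure U)ᶜ := by
    intro z hz
    by_cases hzc : z ∈ closure U
    · left
      rw [closure_eq_interior_union_frontier, hU.interior_eq] at hzc
      rcases hzc with h | h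
      · exact h
      · exact absurd h (Set.disjoint_left.1 hfr hz)
    · exact Or.inr hzc
  have hdisj : Disjoint U (closure U)ᶜ :=
    Set.disjoint_left.2 fun z hz hz' => hz' (subset_closure hz)
  rcases hB.subset_or_subset hU isClosed_closure.isOpen_compl hdisj hcover with h | h
  · exact absurd (h haB) haU
  · exact Set.disjoint_left.2 fun z hz hzU => h hz (subset_closure hzU)

/-- Metric form used in the fence argument: if the ball `B(a, τ)` misses `frontier U` (`U` open)
and its centre is not in `U`, then `B(a, τ) ∩ U = ∅`. [folklore] -/
theorem ball_disjoint_of_disjoint_frontier {a : ℂ} {τ : ℝ} {U : Set ℂ} (hU : IsOpen U)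
    (hfr : Disjoint (ball a τ) (frontier U)) (hτ : 0 < τ) (haU : a ∉ U) :
    Disjoint (ball a τ) U :=
  disjoint_of_isPreconnected_of_disjoint_frontier (convex_ball a τ).isPreconnected hU hfr
    (mem_ball_self hτ) haU

/-- **Dictionary step.** An `ω`-open edge of `Ω_δ` that is closed under the Dobrushin boundary
condition `bcBondConfig` has an endpoint on the dual-wired discrete arc. [folklore] -/
theorem exists_mem_zdArcB_of_not_mem_bcBondConfig (E : DiscreteDobrushin)
    {ω : Percolation.BondConfig (Site 2)} {e : Sym2 (Site 2)}
    (he : e ∈ (discreteDomainGraph E.Ω E.δ).edgeSet) (hω : e ∈ ω)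
    (hbc : e ∉ E.bcBondConfig ω) : ∃ x ∈ e, x ∈ E.zdArcB := by
  by_contra h
  push Not at h
  exact hbc ((E.mem_bcBondConfig_iff).2 ⟨he, Or.inr ⟨hω, h⟩⟩)

/-- The same for an edge `s(x, y)` of the open crossing graph of a SUB-domain, once the eventual
subgraph inclusion `discreteDomainGraph Ω δ ≤ discreteDomainGraph E.Ω E.δ` is available
(`MeshDomainMonotoneG6.lean`): a crossed (bc-closed) edge of the open `Ω_δ`-crossing has an
endpoint on `zdArcB`. [folklore] -/
theorem exists_mem_zdArcB_of_adj_of_not_mem_bcBondConfig (E : DiscreteDobrushin) {Ω : Set ℂ}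
    (hle : discreteDomainGraph Ω E.δ ≤ discreteDomainGraph E.Ω E.δ)
    {ω : Percolation.BondConfig (Site 2)} {x y : Site 2}
    (hxy : (Percolation.openGraph ω ⊓ discreteDomainGraph Ω E.δ).Adj x y)
    (hbc : s(x, y) ∉ E.bcBondConfig ω) : x ∈ E.zdArcB ∨ y ∈ E.zdArcB := by
  have he : s(x, y) ∈ (discreteDomainGraph E.Ω E.δ).edgeSet := by
    rw [SimpleGraph.mem_edgeSet]; exact hle hxy.2
  have hω : s(x, y) ∈ ω := ((Percolation.openGraph_adj ω x y).1 hxy.1).1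
  obtain ⟨z, hz, hzB⟩ := exists_mem_zdArcB_of_not_mem_bcBondConfig E he hω hbc
  rcases Sym2.mem_iff.1 hz with rfl | rfl
  · exact Or.inl hzB
  · exact Or.inr hzB

/-- **Crossing step.** A preconnected set `T ⊆ D` meeting both components `U₁`, `U₂` of
`D ∖ L` (open, disjoint, `U₁ ∪ U₂ = D ∖ L` — Newman's decomposition) meets the cross-cut `L`.
[folklore] -/
theorem inter_nonempty_of_isPreconnected_of_meets {X : Type*} [TopologicalSpace X]
    {T D L U₁ U₂ : Set X} (hT : IsPreconnected T) (hTD : T ⊆ D) (hU : U₁ ∪ U₂ = D \ L)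
    (h₁ : IsOpen U₁) (h₂ : IsOpen U₂) (hd : Disjoint U₁ U₂)
    (hm₁ : (T ∩ U₁).Nonempty) (hm₂ : (T ∩ U₂).Nonempty) : (T ∩ L).Nonempty := by
  by_contra h
  rw [Set.not_nonempty_iff_eq_empty] at h
  have hcover : T ⊆ U₁ ∪ U₂ := by
    rw [hU]
    intro z hz
    exact ⟨hTD hz, fun hzL => (Set.eq_empty_iff_forall_notMem.1 h) z ⟨hz, hzL⟩⟩
  obtain ⟨z₁, hz₁T, hz₁U⟩ := hm₁
  obtain ⟨z₂, hz₂T, hz₂U⟩ := hm₂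
  rcases hT.subset_or_subset h₁ h₂ hd hcover with hsub | hsub
  · exact Set.disjoint_left.1 hd (hsub hz₂T) hz₂U
  · exact Set.disjoint_left.1 hd hz₁U (hsub hz₁T)

end DrefuteG6

end Summit.CriticalPhenomena.CardyFormulaZ2.Cruxes.SLESixFamiliesGiveCardy.CollarTouchSandwich
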